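import Summits.BirchSwinnertonDyer.BirchSwinnertonDyer.Theorems.ManinLocalTwoThreeRigidityImpliesTower

/-!
# LEMMA MH and E-an-142 at a PRIME-POWER MODULUS `p^(k+1)` (P-es-7, step H2 of MEMO-es §38.5-bis; cell bsd-f2-manin, seat
# `bsd-line-manin23-p2` gen 12, integer lifting induction by the es planner g24 `Sketch-es-g24-H2.lean` 020b4a425da8c92b)

Summit `BirchSwinnertonDyer`, route `ManinLocalTwoThree`, crux C2 `ManinOddAtFour` (stmt-BirchSwinnertonDyer-22967), v14 stub 6 (the Γ₁ /
blind-locus half).  The es lens' E-es-111♯ `GammaOneTowerUnitTwist p` (the tower unit-twist law WITHOUT the plus-index hypothesis, in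
Γ₁-normalisation) is the tree's tower theorem `towerUnitTwist_holds` re-run at the modulus `p^(a+1)`, `p^a ∥ [P(Λ_f) : P(Λ₁(f))]`.  Of its four
homogenisation steps (H1 washing, H2 LEMMA MH / E-an-142, H3 telescope, H4 Γ₁-vanishing) H3 (`levelLinear_telescope`) and H4
(`false_of_gamma1_plusPart_dvd` at `PlusIndexPrimeTo (p^(a+1)) f`) are already modulus-generic in the tree.  THIS FILE does H2:

* `intMultiHub_pow` — INTEGER LIFTING INDUCTION (es g24): if every even solution `ZMod q → ZMod p` of the multi-hub 4-term relation is
  constant on non-zero arguments (`MultiHubRigid q p`), then every even `G : ZMod q → ℤ` whose 4-term relations vanish mod `p^k` is constant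
  mod `p^k` on non-zero arguments (constants solve the relation EXACTLY, so `(G − G 1)/p` is again a solution one level down);
* `multiHubRigid_pow : MultiHubRigid q p → MultiHubRigid q (p^(k+1))`; **`multiHubRigid_primePow`**: LEMMA MH at every prime power
  `p^(k+1)` under the tree's hypotheses `q, p` prime, `3 ≤ q`, `q ≠ p`, `p ∤ (q−1)/2` (from `multiHubRigidLaw_holds`);
* **`tvPattern_levelLinear_of_multiHubRigid`** — E-an-142's conclusion at an ARBITRARY modulus `M` given `MultiHubRigid q M` (the proof of
  `tvPattern_levelLinear_of_three_le` uses primality of the modulus only through LEMMA MH; `tv_resolution`, `eq_zero_of_tv_zero`,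
  `tv_classIndep`, `fine_multiHub`, `tv_conclusion_of_classIndep` take `¬ q ∣ M` only), and **`tvPattern_levelLinear_primePow`** (modulus `p^(k+1)`).

HONEST FRAMING: bookkeeping toward P-es-7; nothing about Manin's conjecture or BSD is asserted; C2/C3 OPEN.  No definitions, no sorry.
-/

set_option linter.dupNamespace false
set_option autoImplicit false

open scoped MatrixGroups

open Summit.BirchSwinnertonDyer.Rank1Residual.ManinAdditive.TowerExtension

namespace Summit.BirchSwinnertonDyer.BirchSwinnertonDyer.Theorems.ManinLocalTwoThree

namespace MultiHubPrimePow

/-! ### §1 Integer lifting induction (es g24 `Sketch-es-g24-H2.lean`, `hubRel` expanded) -/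

/-- **INTEGER LIFTING INDUCTION** (es g24): `MultiHubRigid q p` ⟹ every even `G : ZMod q → ℤ` whose multi-hub relations
`G h − G (hD) − G (h(1−D)D⁻¹) + G (h(1−D))` vanish mod `p^k` (`h, D ≠ 0`, `D ≠ 1`) is constant mod `p^k` on non-zero arguments. -/
theorem intMultiHub_pow {q p : ℕ} [Fact q.Prime] (hp : p.Prime) (hMH : MultiHubRigid q p) :
    ∀ (k : ℕ) (G : ZMod q → ℤ), (∀ x, G (-x) = G x) →
      (∀ h D : ZMod q, h ≠ 0 → D ≠ 0 → D ≠ 1 →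
        ((p : ℤ) ^ k) ∣ G h - G (h * D) - G (h * (1 - D) * D⁻¹) + G (h * (1 - D))) →
      ∀ x y : ZMod q, x ≠ 0 → y ≠ 0 → ((p : ℤ) ^ k) ∣ G x - G y := by
  haveI : NeZero p := ⟨hp.ne_zero⟩
  intro k
  induction k with
  | zero => intro G _ _ x y _ _; simp
  | succ k ih =>
    intro G hev hrel x y hx hy
    -- Step 1: reduce mod `p` and apply `MultiHubRigid q p`
    have hmodp : ∀ z : ZMod q, z ≠ 0 → (p : ℤ) ∣ G z - G 1 := by
      intro z hz
      have hG : (fun w : ZMod q => ((G w : ℤ) : ZMod p)) z = (fun w : ZMod q => ((G w : ℤ) : ZMod p)) 1 := by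
        refine hMH (fun w => ((G w : ℤ) : ZMod p)) ?_ ?_ z 1 hz one_ne_zero
        · intro w; simp [hev w]
        · intro h D hh hD hD1
          have hdvd : (p : ℤ) ∣ G h - G (h * D) - G (h * (1 - D) * D⁻¹) + G (h * (1 - D)) :=
            dvd_trans (dvd_pow_self (p : ℤ) (Nat.succ_ne_zero k)) (hrel h D hh hD hD1)
          have := (ZMod.intCast_zmod_eq_zero_iff_dvd _ p).mpr hdvd
          simpa [Int.cast_sub, Int.cast_add] using this
      have h0 : (((G z - G 1 : ℤ)) : ZMod p) = 0 := by
        rw [Int.cast_sub, sub_eq_zero]; exact hG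
      exact (ZMod.intCast_zmod_eq_zero_iff_dvd _ p).mp h0
    -- Step 2: the quotient function one level down
    choose w hw using hmodp
    classical
    let G' : ZMod q → ℤ := fun z => if hz : z = 0 then 0 else w z hz
    have hG'spec : ∀ z : ZMod q, z ≠ 0 → G z - G 1 = (p : ℤ) * G' z := by
      intro z hz; simp only [G', dif_neg hz]; exact hw z hz
    have hev' : ∀ z, G' (-z) = G' z := by
      intro z
      by_cases hz : z = 0
      · simp [G', hz]
      · have hnz : -z ≠ 0 := neg_ne_zero.mpr hz
        have h1 := hG'spec z hz
        have h2 := hG'spec (-z) hnz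
        rw [hev z] at h2
        have : (p : ℤ) * G' (-z) = (p : ℤ) * G' z := by rw [← h1, ← h2]
        exact mul_left_cancel₀ (by exact_mod_cast hp.ne_zero) this
    have hrel' : ∀ h D : ZMod q, h ≠ 0 → D ≠ 0 → D ≠ 1 →
        ((p : ℤ) ^ k) ∣ G' h - G' (h * D) - G' (h * (1 - D) * D⁻¹) + G' (h * (1 - D)) := by
      intro h D hh hD hD1
      have h1D : (1 - D) ≠ 0 := sub_ne_zero.mpr (Ne.symm hD1)
      have hDinv : D⁻¹ ≠ 0 := inv_ne_zero hD
      have ha : h * D ≠ 0 := mul_ne_zero hh hD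
      have hb : h * (1 - D) * D⁻¹ ≠ 0 := mul_ne_zero (mul_ne_zero hh h1D) hDinv
      have hc : h * (1 - D) ≠ 0 := mul_ne_zero hh h1D
      have e1 := hG'spec h hh
      have e2 := hG'spec _ ha
      have e3 := hG'spec _ hb
      have e4 := hG'spec _ hc
      have key : (p : ℤ) * (G' h - G' (h * D) - G' (h * (1 - D) * D⁻¹) + G' (h * (1 - D))) =
          G h - G (h * D) - G (h * (1 - D) * D⁻¹) + G (h * (1 - D)) := by
        linear_combination -e1 + e2 + e3 - e4
      have hdvd := hrel h D hh hD hD1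
      rw [← key, pow_succ'] at hdvd
      exact (mul_dvd_mul_iff_left (by exact_mod_cast hp.ne_zero : (p : ℤ) ≠ 0)).mp hdvd
    -- Step 3: induct
    have hxy := ih G' hev' hrel' x y hx hy
    have : G x - G y = (p : ℤ) * (G' x - G' y) := by
      have h1 := hG'spec x hx; have h2 := hG'spec y hy
      linear_combination h1 - h2
    rw [this, pow_succ']
    exact mul_dvd_mul_left (p : ℤ) hxy

/-- **H2b (es g24): `MultiHubRigid q p → MultiHubRigid q (p ^ (k + 1))`** for prime `q`, `p`. -/
theorem multiHubRigid_pow {q p : ℕ} [Fact q.Prime] (hp : p.Prime) (hMH : MultiHubRigid q p) (k : ℕ) :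
    MultiHubRigid q (p ^ (k + 1)) := by
  haveI : NeZero (p ^ (k + 1)) := ⟨pow_ne_zero _ hp.ne_zero⟩
  intro G hev hrel x y hx hy
  -- integer lift via `val`
  let Gz : ZMod q → ℤ := fun z => ((G z).val : ℤ)
  have hcast : ∀ z, ((Gz z : ℤ) : ZMod (p ^ (k + 1))) = G z := by
    intro z; simp [Gz]
  have hevz : ∀ z, Gz (-z) = Gz z := by intro z; simp [Gz, hev z]
  have hrelz : ∀ h D : ZMod q, h ≠ 0 → D ≠ 0 → D ≠ 1 →
      ((p : ℤ) ^ (k + 1)) ∣ Gz h - Gz (h * D) - Gz (h * (1 - D) * D⁻¹) + Gz (h * (1 - D)) := by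
    intro h D hh hD hD1
    have h0 : ((Gz h - Gz (h * D) - Gz (h * (1 - D) * D⁻¹) + Gz (h * (1 - D)) : ℤ) : ZMod (p ^ (k + 1))) = 0 := by
      simp only [Int.cast_add, Int.cast_sub, hcast]
      exact hrel h D hh hD hD1
    have := (ZMod.intCast_zmod_eq_zero_iff_dvd _ (p ^ (k + 1))).mp h0
    exact_mod_cast this
  have hdvd := intMultiHub_pow hp hMH (k + 1) Gz hevz hrelz x y hx hy
  have h0 : (((Gz x - Gz y : ℤ)) : ZMod (p ^ (k + 1))) = 0 :=
    (ZMod.intCast_zmod_eq_zero_iff_dvd _ (p ^ (k + 1))).mpr (by exact_mod_cast hdvd)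
  rw [Int.cast_sub, hcast, hcast, sub_eq_zero] at h0
  exact h0

/-- **LEMMA MH AT EVERY PRIME POWER**: for primes `q ≥ 3`, `p ≠ q` with `p ∤ (q−1)/2`, `MultiHubRigid q (p^(k+1))`
(`multiHubRigidLaw_holds` + lifting). -/
theorem multiHubRigid_primePow {q p : ℕ} (hq : q.Prime) (hp : p.Prime) (hq3 : 3 ≤ q) (hqp : q ≠ p)
    (hadm : ¬ p ∣ (q - 1) / 2) (k : ℕ) : MultiHubRigid q (p ^ (k + 1)) := by
  haveI : Fact q.Prime := ⟨hq⟩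
  exact multiHubRigid_pow hp (multiHubRigidLaw_holds q p hq hp hq3 hqp hadm) k

/-! ### §2 E-an-142 at an arbitrary modulus given LEMMA MH there -/

/-- **E-an-142's conclusion at an ARBITRARY modulus `M`, given `MultiHubRigid q M`** (for `q ≥ 3` prime, `q ∤ M·N`): the proof of
`tvPattern_levelLinear_of_three_le` verbatim with LEMMA MH supplied as a hypothesis — primality of the modulus is used nowhere else. -/
theorem tvPattern_levelLinear_of_multiHubRigid {N q M : ℕ} (hq : q.Prime) (hqMN : ¬ q ∣ M * N) (hMH : MultiHubRigid q M)
    (hN : 0 < N) (a κ : ZMod M) (s : ℕ) (g : ℕ → ℤ → ZMod M) (c : SL(2, ℤ) → ZMod M)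
    (level0 : ∀ r : ℤ, g 0 r = 0)
    (period : ∀ (n : ℕ) (r : ℤ), g n (r + (q : ℤ) ^ n) = g n r)
    (unreduce : ∀ (n : ℕ) (r : ℤ), g (n + 1) ((q : ℤ) * r) = g n r)
    (even : ∀ (n : ℕ) (r : ℤ), g n (-r) = g n r)
    (tv : ∀ (n : ℕ) (r : ℤ), s + 1 ≤ n → IsCoprime r (q : ℤ) → g n (r + (q : ℤ) ^ (n - 1)) = g n r)
    (kappa : κ = ∑ t ∈ Finset.range q, g 1 (t : ℤ))
    (hecke : ∀ (m : ℕ) (r : ℤ), ∑ t ∈ Finset.range q, g (m + 1) (r + (t : ℤ) * (q : ℤ) ^ m) = a * g m r - g (m - 1) r + κ)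
    (inv : ∀ γ : SL(2, ℤ), (N : ℤ) ∣ (γ : Matrix (Fin 2) (Fin 2) ℤ) 1 0 →
      ∀ (r : ℤ) (i j : ℕ) (ε : ℤˣ),
        (γ : Matrix (Fin 2) (Fin 2) ℤ) 1 0 * r + (γ : Matrix (Fin 2) (Fin 2) ℤ) 1 1 * (q : ℤ) ^ i = (ε : ℤ) * (q : ℤ) ^ j →
        g j ((ε : ℤ) * ((γ : Matrix (Fin 2) (Fin 2) ℤ) 0 0 * r + (γ : Matrix (Fin 2) (Fin 2) ℤ) 0 1 * (q : ℤ) ^ i)) - g i r = c γ) :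
    ∃ κ' : ZMod M, ∀ (n : ℕ) (r : ℤ), IsCoprime r (q : ℤ) → g n r = κ' * (n : ZMod M) := by
  have hqp : ¬ q ∣ M := fun h => hqMN (dvd_mul_of_dvd_left h N)
  have hqN : Nat.Coprime q N := (Nat.Prime.coprime_iff_not_dvd hq).mpr fun h => hqMN (dvd_mul_of_dvd_right h M)
  rcases Nat.eq_zero_or_pos s with rfl | hs
  · exact ⟨0, fun n r _ => by rw [eq_zero_of_tv_zero g hq hqp a κ level0 period unreduce tv kappa hecke n r, zero_mul]⟩
  · have hres := tv_resolution g hq hqp a κ level0 period unreduce tv kappa hecke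
    have hci := tv_classIndep hq hqN hs level0 period unreduce even hMH hres
      (TVRigidity.fine_multiHub level0 period even inv hres hq hqMN hN hs)
    exact TVRigidity.tv_conclusion_of_classIndep hq hqMN hN hs level0 period even inv hres hci

/-- **E-an-142 AT THE PRIME-POWER MODULUS `p^(k+1)`**: for primes `q ≥ 3`, `p` with `q ∤ p·N`, `p ∤ (q−1)/2`, `N ≥ 1`, the data
(P0) (P1) (P2) (EV) (TV) (HK) (inv) with values in `ZMod (p^(k+1))` have the LEVEL-LINEAR pattern `g n r = κ'·n` on `q ∤ r`. -/
theorem tvPattern_levelLinear_primePow {N q p : ℕ} (hp : p.Prime) (hq : q.Prime) (hq3 : 3 ≤ q) (hqpN : ¬ q ∣ p * N)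
    (hadm : ¬ p ∣ (q - 1) / 2) (hN : 0 < N) (k : ℕ) (a κ : ZMod (p ^ (k + 1))) (s : ℕ) (g : ℕ → ℤ → ZMod (p ^ (k + 1)))
    (c : SL(2, ℤ) → ZMod (p ^ (k + 1)))
    (level0 : ∀ r : ℤ, g 0 r = 0)
    (period : ∀ (n : ℕ) (r : ℤ), g n (r + (q : ℤ) ^ n) = g n r)
    (unreduce : ∀ (n : ℕ) (r : ℤ), g (n + 1) ((q : ℤ) * r) = g n r)
    (even : ∀ (n : ℕ) (r : ℤ), g n (-r) = g n r)
    (tv : ∀ (n : ℕ) (r : ℤ), s + 1 ≤ n → IsCoprime r (q : ℤ) → g n (r + (q : ℤ) ^ (n - 1)) = g n r)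
    (kappa : κ = ∑ t ∈ Finset.range q, g 1 (t : ℤ))
    (hecke : ∀ (m : ℕ) (r : ℤ), ∑ t ∈ Finset.range q, g (m + 1) (r + (t : ℤ) * (q : ℤ) ^ m) = a * g m r - g (m - 1) r + κ)
    (inv : ∀ γ : SL(2, ℤ), (N : ℤ) ∣ (γ : Matrix (Fin 2) (Fin 2) ℤ) 1 0 →
      ∀ (r : ℤ) (i j : ℕ) (ε : ℤˣ),
        (γ : Matrix (Fin 2) (Fin 2) ℤ) 1 0 * r + (γ : Matrix (Fin 2) (Fin 2) ℤ) 1 1 * (q : ℤ) ^ i = (ε : ℤ) * (q : ℤ) ^ j →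
        g j ((ε : ℤ) * ((γ : Matrix (Fin 2) (Fin 2) ℤ) 0 0 * r + (γ : Matrix (Fin 2) (Fin 2) ℤ) 0 1 * (q : ℤ) ^ i)) - g i r = c γ) :
    ∃ κ' : ZMod (p ^ (k + 1)), ∀ (n : ℕ) (r : ℤ), IsCoprime r (q : ℤ) → g n r = κ' * (n : ZMod (p ^ (k + 1))) := by
  have hqp : ¬ q ∣ p := fun h => hqpN (dvd_mul_of_dvd_left h N)
  have hqnep : q ≠ p := fun h => hqp (h ▸ dvd_rfl)
  have hqpkN : ¬ q ∣ p ^ (k + 1) * N := by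
    intro h
    rcases (Nat.Prime.dvd_mul hq).mp h with h1 | h1
    · exact hqp (hq.dvd_of_dvd_pow h1)
    · exact hqpN (dvd_mul_of_dvd_right h1 p)
  exact tvPattern_levelLinear_of_multiHubRigid hq hqpkN (multiHubRigid_primePow hq hp hq3 hqnep hadm k) hN a κ s g c
    level0 period unreduce even tv kappa hecke inv

end MultiHubPrimePow

end Summit.BirchSwinnertonDyer.BirchSwinnertonDyer.Theorems.ManinLocalTwoThree
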